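import Mathlib
import Summits.ValiantsHypothesis.ValiantsHypothesis.Theorems.KPlusLogSqLawWeakLiftingTowerGraftSkewBlockIdentityGraftSharp

/-!
# Tower graft line — Θ(m²) IDENTITY-GRAFT PHANTOMS ON GENUINE TOWERS, EVERY EVEN SIZE (S4's object, inside `IsTower`)

Calibration file for the line `Cruxes/WeakLifting/Lines/tower_graft.lean` (crux `WeakLifting` = stmt-ValiantsHypothesis-19561), object of S4
`stub_graftLawId` (`IsTower m d`, `m·dₗ < D`).  NO stub is claimed.  `…IdentityGraftSharp.skewBlock_identityGraft_quadratic` leaves the support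
existential (it comes out of `¬ PosRootLawAt`); here the tree's Descartes-sharp witness is used BY NAME — the arrowhead Lagrange tower
`witnessLetters k D` on `witnessExps D = (0, 1, D)` (`…KThreeColumnLawHolds`) — with its lacunarity `D` pushed above any bound, so that the
support is a genuine `m`-tower for the skew-block size `m = 2k` and the far exponent sits above the tower:

* `exists_large_D_alternating` — `…KThreeColumnLawHolds.exists_D_alternating` with `D ≥ b` (same filter argument, `eventually_ge_atTop`);
* `le_card_posRoots_witness` — for `k ≥ 1` and every `b` some `D ≥ b` gives the witness pencil `≥ C(k+2,2) − 1` distinct positive roots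
  (the counting step of `not_posRootLawAt_three`, verbatim);
* `skewBlock_identityGraft_quadratic_tower (q)` — **for every `q` (k = q+1, m = 2k): symmetric three-letter blocks on the GENUINE m-TOWER
  `(0, 1, D)` (tower inequalities and `m·dₗ < D'` are conjuncts), a far exponent `D'` and `η > 0` with `Z₊(det G_η) = 0` and
  `Z₊(det(G_η + X^{D'}·1)) ≥ (q+1)(q+4) = m²/4 + 3m/2`.**

READING (NO-GO ledger, kill-shape #38⁺, S4 row): «`Z₊(det(G + X^D·1)) ≤ c·(eigenvalue or digit events) + g(m)`» needs `g(m) ≥ m²/4 + 3m/2` EVEN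
INSIDE THE TOWER CLASS at every even `m` (p703592: `2m`; p701122: `3m` off-tower).  Inside the class budget `C(m+2,2) − 1`; ZERO crux credit.
HONEST FRAMING: nothing on S4/S4b/S5/S5ᴸ, TowerB, `WeakLifting`, Conjecture B, `MatrixDescartes` (18050) or `VP ≠ VNP`.  Def-free.
Seat: prover val-sym-lift-p2 g20, `--supports stmt-ValiantsHypothesis-19561`.
-/

-- `Summit.ValiantsHypothesis.ValiantsHypothesis.…` repeats a component by the D-0017 layout
-- (single-conjunct summit), which the `dupNamespace` linter flags; the name is mandated.
set_option linter.dupNamespace false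

namespace Summit.ValiantsHypothesis.ValiantsHypothesis.Theorems.KPlusLogSqLaw.TowerGraft

open Polynomial Matrix Filter Topology
open scoped BigOperators Polynomial
open Summit.ValiantsHypothesis.ValiantsHypothesis.Theorems.LacunarySymmetroidMatrixDescartes.Census.LagrangeTower

section IdentityGraftSharpTower

/-- `exists_D_alternating` of `…KThreeColumnLawHolds` with the lacunarity `D` above a prescribed bound (adapted from that file: the same
`atTop` filter argument, intersected with `eventually_ge_atTop`). -/
theorem exists_large_D_alternating (m b : ℕ) :
    ∃ D : ℕ, b ≤ D ∧ ∀ n : ℕ, n < tri (m + 1) - 1 →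
      Matrix.det ((tower m).A + pts m n • (tower m).B + diagonal (fun a : Fin m => sgn a * (pts m n / thr a) ^ D)) *
        Matrix.det ((tower m).A + pts m (n + 1) • (tower m).B +
          diagonal (fun a : Fin m => sgn a * (pts m (n + 1) / thr a) ^ D)) < 0 := by
  set N := tri (m + 1) - 1
  have hall : ∀ᶠ D : ℕ in atTop, ∀ n : Fin N,
      Matrix.det ((tower m).A + pts m n • (tower m).B + diagonal (fun a : Fin m => sgn a * (pts m n / thr a) ^ D)) *
        Matrix.det ((tower m).A + pts m (n + 1) • (tower m).B +
          diagonal (fun a : Fin m => sgn a * (pts m (n + 1) / thr a) ^ D)) < 0 := by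
    refine eventually_all.mpr fun n => ?_
    have ha := eventually_sign_at m n (by omega)
    have hb := eventually_sign_at m (n + 1) (by omega)
    have hE := Ewalk_mul_succ_neg m n n.isLt
    filter_upwards [ha, hb] with D hDa hDb
    set x := Matrix.det ((tower m).A + pts m n • (tower m).B + diagonal (fun a : Fin m => sgn a * (pts m n / thr a) ^ D))
    set y := Matrix.det ((tower m).A + pts m (n + 1) • (tower m).B +
      diagonal (fun a : Fin m => sgn a * (pts m (n + 1) / thr a) ^ D))
    have hxy : (x * y) * (Ewalk m n * Ewalk m (n + 1)) > 0 := by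
      have : (x * y) * (Ewalk m n * Ewalk m (n + 1)) = (x * Ewalk m n) * (y * Ewalk m (n + 1)) := by ring
      rw [this]; exact mul_pos hDa hDb
    by_contra hc
    have hc' : 0 ≤ x * y := not_lt.mp hc
    have := mul_nonpos_of_nonneg_of_nonpos hc' hE.le
    exact absurd hxy (not_lt.mpr this)
  obtain ⟨D, hDb, hD⟩ := ((eventually_ge_atTop b).and hall).exists
  exact ⟨D, hDb, fun n hn => hD ⟨n, hn⟩⟩

/-- the witness pencil of `…KThreeColumnLawHolds` with large lacunarity has `C(m+2,2) − 1` distinct positive roots (the counting step of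
`not_posRootLawAt_three`, adapted). -/
theorem le_card_posRoots_witness (m : ℕ) (hm : 1 ≤ m) (b : ℕ) :
    ∃ D : ℕ, b ≤ D ∧ Nat.choose (m + 2) 2 - 1 ≤
      ((Matrix.det (∑ l, ((X : ℝ[X]) ^ witnessExps D l) • (witnessLetters m D l).map C)).roots.toFinset.filter
        (fun t => 0 < t)).card := by
  obtain ⟨D, hDb, hD⟩ := exists_large_D_alternating m b
  refine ⟨D, hDb, ?_⟩
  set N := tri (m + 1) - 1 with hN
  have hNchoose : tri (m + 1) = Nat.choose (m + 2) 2 := tri_eq_choose (m + 1)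
  have htri2 : 2 ≤ tri (m + 1) := by
    rw [show tri (m + 1) = tri m + (m + 1) from rfl]
    have : 1 ≤ tri m := by
      obtain ⟨m', rfl⟩ : ∃ m', m = m' + 1 := ⟨m - 1, by omega⟩
      rw [show tri (m' + 1) = tri m' + (m' + 1) from rfl]; omega
    omega
  let τ : Fin (N + 1) → ℝ := fun i => pts m i
  have hτ : StrictMono τ := by
    refine Fin.strictMono_iff_lt_succ.mpr fun i => ?_
    show pts m (Fin.castSucc i) < pts m i.succ
    rw [Fin.val_castSucc, Fin.val_succ]
    exact pts_lt_succ m i (by omega)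
  have hpos : ∀ i, 0 < τ i := fun i => pts_pos m i
  set p := Matrix.det (∑ l, ((X : ℝ[X]) ^ witnessExps D l) • (witnessLetters m D l).map C) with hp
  have halt : ∀ i : Fin N, p.eval (τ i.castSucc) * p.eval (τ i.succ) < 0 := by
    intro i
    show p.eval (pts m (Fin.castSucc i)) * p.eval (pts m i.succ) < 0
    rw [Fin.val_castSucc, Fin.val_succ, hp, eval_det_witness, eval_det_witness]
    exact hD i i.isLt
  have hcount := Literature.LinearAlgebra.MatrixPolynomials.CameronPsarrakos2019.le_card_posRoots_of_alternating p N τ hτ hpos halt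
  omega

/-- **Θ(m²) IDENTITY-GRAFT PHANTOMS ON GENUINE TOWERS, every even size** (S4's object; calibration).  For every `q` (`k = q+1`, `m = 2k`):
the rescaled arrowhead Lagrange tower blocks (symmetric) on the support `(0, 1, D)` — an `m`-tower — a far exponent `D'` above the tower and an
`η > 0` give `Z₊(det G_η) = 0` and `Z₊(det(G_η + X^{D'}·1)) ≥ (q+1)(q+4) = m²/4 + 3m/2`. [this work] -/
theorem skewBlock_identityGraft_quadratic_tower (q : ℕ) :
    ∃ (D : ℕ) (B : Fin 3 → Matrix (Fin (q + 1)) (Fin (q + 1)) ℝ) (D' : ℕ) (η : ℝ), 0 < η ∧ (∀ l, (B l).IsSymm) ∧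
      (∀ l l' : Fin 3, l < l' → 2 * (q + 1) * (![0, 1, D] : Fin 3 → ℕ) l < (![0, 1, D] : Fin 3 → ℕ) l') ∧
      (∀ l : Fin 3, 2 * (q + 1) * (![0, 1, D] : Fin 3 → ℕ) l < D') ∧
      ((∑ l, (X : ℝ[X]) ^ (![0, 1, D] : Fin 3 → ℕ) l •
        (Matrix.fromBlocks (if l = 0 then η • (1 : Matrix (Fin (q + 1)) (Fin (q + 1)) ℝ) else 0)
        (B l) (B l)ᵀ (if l = 0 then -(η • (1 : Matrix (Fin (q + 1)) (Fin (q + 1)) ℝ)) else 0)).map C).det.roots.toFinset.filter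
        (fun t => 0 < t)).card = 0 ∧
      (q + 1) * (q + 4) ≤ ((((∑ l, (X : ℝ[X]) ^ (![0, 1, D] : Fin 3 → ℕ) l •
          (Matrix.fromBlocks (if l = 0 then η • (1 : Matrix (Fin (q + 1)) (Fin (q + 1)) ℝ) else 0) (B l) (B l)ᵀ
          (if l = 0 then -(η • (1 : Matrix (Fin (q + 1)) (Fin (q + 1)) ℝ)) else 0)).map C) +
        (X : ℝ[X]) ^ D' • (1 : Matrix (Fin (q + 1) ⊕ Fin (q + 1)) (Fin (q + 1) ⊕ Fin (q + 1)) ℝ[X])).det).roots.toFinset.filter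
        (fun t => 0 < t)).card := by
  classical
  obtain ⟨D, hDb, hcard⟩ := le_card_posRoots_witness (q + 1) (by omega) (2 * (q + 1) + 1)
  have hexps : witnessExps D = (![0, 1, D] : Fin 3 → ℕ) := rfl
  rw [hexps] at hcard
  have hch : Nat.choose (q + 1 + 2) 2 = Nat.choose (q + 3) 2 := by rw [show q + 1 + 2 = q + 3 by ring]
  rw [hch] at hcard
  set S := witnessLetters (q + 1) D with hS
  have hSsymm : ∀ l, (S l).IsSymm := witnessLetters_isSymm (q + 1) D
  -- restate the count on this file's spelling of the pencil (definitionally the same term)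
  have hcard' : Nat.choose (q + 3) 2 - 1 ≤
      ((∑ l, (X : ℝ[X]) ^ (![0, 1, D] : Fin 3 → ℕ) l • (S l).map C).det.roots.toFinset.filter (fun t => 0 < t)).card := hcard
  clear hcard
  have hdet : (∑ l, (X : ℝ[X]) ^ (![0, 1, D] : Fin 3 → ℕ) l • (S l).map C).det ≠ 0 := by
    intro h0
    rw [h0, Polynomial.roots_zero, Multiset.toFinset_zero, Finset.filter_empty, Finset.card_empty] at hcard'
    have h2 : Nat.choose (0 + 3) 2 ≤ Nat.choose (q + 3) 2 := Nat.choose_le_choose 2 (by omega)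
    have h3 : Nat.choose (0 + 3) 2 = 3 := by decide
    omega
  have hsupp := LacunarySymmetroidMatrixDescartes.StubDescartesCeiling.card_support_det_pencil_le (![0, 1, D] : Fin 3 → ℕ) S
  have hch2 : Nat.choose (q + 1 + 3 - 1) (q + 1) = Nat.choose (q + 3) 2 := by
    rw [show q + 1 + 3 - 1 = q + 3 by omega, show q + 3 = (q + 1) + 2 by ring, Nat.choose_symm_add]
  rw [hch2] at hsupp
  have hsharp : (∑ l, (X : ℝ[X]) ^ (![0, 1, D] : Fin 3 → ℕ) l • (S l).map C).det.support.card ≤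
      ((∑ l, (X : ℝ[X]) ^ (![0, 1, D] : Fin 3 → ℕ) l • (S l).map C).det.roots.toFinset.filter (fun t => 0 < t)).card + 1 := by
    omega
  obtain ⟨Λ, hΛ, D₀, hD₀⟩ := skewBlock_identityGraft_of_sharp (![0, 1, D] : Fin 3 → ℕ) 0 S hdet hsharp
  obtain ⟨η, hη, h1, h2⟩ := hD₀ (max D₀ (2 * (q + 1) * D + 1)) (le_max_left _ _)
  refine ⟨D, fun l => Λ ^ (![0, 1, D] : Fin 3 → ℕ) l • S l, max D₀ (2 * (q + 1) * D + 1), η, hη, fun l => (hSsymm l).smul _,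
    ?_, ?_, h1, le_trans ?_ h2⟩
  · rintro ⟨l, hl⟩ ⟨l', hl'⟩ hll'
    rw [Fin.mk_lt_mk] at hll'
    interval_cases l <;> interval_cases l' <;> first | omega | (simp <;> omega)
  · rintro ⟨l, hl⟩
    refine lt_of_lt_of_le ?_ (le_max_right _ _)
    interval_cases l
    · simp
    · simp
      omega
    · simp
  · have := two_mul_choose_sub_one q
    omega

end IdentityGraftSharpTower

end Summit.ValiantsHypothesis.ValiantsHypothesis.Theorems.KPlusLogSqLaw.TowerGraft
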